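import Literature.Analysis.FluidPDE.AxisymPoloidalPart
import Literature.Analysis.FluidPDE.VorticityStretching
import Mathlib.Analysis.SpecialFunctions.Sqrt
import HarnessLib

/-!
# Crux `ExtremiserTransience.NearExtremalTransience` (stmt-NavierStokesRegularity-21883), line `extremiser_liouville`,
# stub K1b — AN EXPLICIT NON-CONSTANT CONSTANT-SPEED DIVERGENCE-FREE FIELD WITH A FAR FIELD
# (the soft part of the residue class is NOT empty)

`--supports stmt-NavierStokesRegularity-21883` (helper).  Author: prover seat `ns-el-k1b` (g4).

After g2/g3, K1b ⟺ «no constant-speed analytic extended extremiser» (`…Plateau`), and the L² flux Liouville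
(`…ConstantSpeedL2Liouville{,General}`) kills every such object with `∫‖w − c‖² < ∞`.  One might hope that the
remaining gap closes SOFTLY, i.e. that «smooth, divergence free, constant speed `‖w‖ ≡ M`, far field `w → c`
(`‖c‖ = M`), finite Dirichlet energy» already forces `w ≡ c` (a Liouville theorem WITHOUT the extremality /
KKT information).  THIS FILE SHOWS IT DOES NOT: the explicit axisymmetric field (cylindrical components, `M = 1`,
`u = x₀² + x₁²`, `b = x₂² + 1`, `Q = u + b = ‖x‖² + 1`)

  `v_r = −u^{1/2}·u x₂ / Q³`,  `v_φ = u^{1/2}·√N / Q³`,  `v_z = 1 − u b / Q³`,  `N = 2 b Q³ − u b² − u² x₂²`,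

i.e. `v(x) = fc(x)·(x₀, x₁, 0) + gc(x)·(−x₁, x₀, 0) + (1 + hc(x))·e₃` with `fc = −u x₂/Q³`, `gc = √N/Q³`,
`hc = −u b/Q³`, is smooth and REAL ANALYTIC (`N ≥ (3/2)·b·Q³ > 0`; `contDiff_field` for every `n ≤ ω`,
`analyticOnNhd_field`), DIVERGENCE FREE (`isDivFree_field`: `div v = 2fc + ⟪∇fc,(x₀,x₁,0)⟫ + ⟪∇gc, Jx⟫ + ∂₂hc`,
the swirl term vanishes by axisymmetry and `2∂_u(u fc) + ∂₂hc = 0`), has CONSTANT SPEED `‖v‖ ≡ 1`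
(`norm_field`: `u fc² + u gc² + (1 + hc)² = 1` identically — the swirl `gc` is DEFINED to close the speed budget
of the poloidal part, whose Stokes stream function is `Ψ = u/2 − u²/(4Q²)` with `|∇Ψ| ≤ r`), and is NOT
constant (`field_zero : v 0 = e₃`, `field_single_zero_apply_two : v(e₀)₂ = 7/8`).  THIS FILE (1/2) stops here;
the sequel `…ConstantSpeedExampleFarField` proves `‖v(x) − e₃‖² = 2u/Q² ≤ 2/(‖x‖² + 1)` (far field `e₃`,
`v − e₃ = O(|x|⁻¹)`, swirl-dominated), `‖v − e₃‖² ∉ L¹` (by the L² flux Liouville of this line) and the packaged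
existence statement in the vocabulary of K1b.
Numerically (this seat, NOT formalised): `Z = ∫‖curl v‖² ≈ 17.3`, `W = ∫‖∇curl v‖² ≈ 49.3`, `‖Dv‖ ≤ 2/Q`,
`‖D²v‖ ≤ 4.3/Q` (bounded gradient, `D¹v, D²v ∈ L²`: the full admissible class of K1b), and `S = ∫⟪ω, Dv ω⟫ = 0`
(the field is anti-invariant under the rotation by `π` about the `x₀`-axis, which flips the sign of `S`).

CONSEQUENCE FOR THE LINE.  Any proof of K1b must use the variational information (KKT multiplier, E–L system,
sign law, `q ∈ L¹`; records `Lines/extremiser_liouville_k1b_{plateau,multiplier}.md`): the function-space /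
constant-speed / divergence / analyticity / far-field structure alone admits non-trivial objects, with exactly the
`|x|⁻¹` swirl tail that the heuristic far-field analysis (record item 7) can only exclude via the multiplier.

WHAT THIS IS NOT: not a K1b counterexample (the field is not claimed extremal; indeed `S = 0`); K1b is NOT
proved; nothing here proves NS regularity. [folklore]
-/

noncomputable section

open Set Filter Topology MeasureTheory Metric Function
open scoped ENNReal NNReal Topology InnerProductSpace RealInnerProductSpace ContDiff
open Literature.Analysis.FluidPDE Literature.Analysis

namespace Summit.NavierStokesRegularity.NavierStokesRegularity.Theorems

-- the problem directory repeats the summit name (`NavierStokesRegularity/NavierStokesRegularity`)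
set_option linter.dupNamespace false

namespace ExtremiserLiouville

namespace ConstantSpeedExample

local notation "E3" => EuclideanSpace ℝ (Fin 3)

/-! ## The scalar building blocks -/

/-- `u = x₀² + x₁²` (squared distance to the axis). [folklore] -/
def uu (x : E3) : ℝ := x 0 ^ 2 + x 1 ^ 2

/-- `b = x₂² + 1`. [folklore] -/
def bb (x : E3) : ℝ := x 2 ^ 2 + 1

/-- `Q = u + b = ‖x‖² + 1`. [folklore] -/
def QQ (x : E3) : ℝ := uu x + bb x

/-- `N = 2 b Q³ − u b² − u² x₂²`, the (positive) radicand of the swirl coefficient. [folklore] -/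
def NN (x : E3) : ℝ := 2 * bb x * QQ x ^ 3 - uu x * bb x ^ 2 - uu x ^ 2 * x 2 ^ 2

/-- Radial coefficient `fc = −u x₂ / Q³` (`v_r = r·fc`). [folklore] -/
def fc (x : E3) : ℝ := -(uu x * x 2) / QQ x ^ 3

/-- Swirl coefficient `gc = √N / Q³` (`v_φ = r·gc`). [folklore] -/
def gc (x : E3) : ℝ := Real.sqrt (NN x) / QQ x ^ 3

/-- Axial deficit `hc = −u b / Q³` (`v_z = 1 + hc`). [folklore] -/
def hc (x : E3) : ℝ := -(uu x * bb x) / QQ x ^ 3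

/-- The horizontal position vector `(x₀, x₁, 0)`. [folklore] -/
def hz (x : E3) : E3 := x - (x 2) • EuclideanSpace.single (2 : Fin 3) (1 : ℝ)

/-- **The example field** `v = fc·(x₀,x₁,0) + gc·(−x₁,x₀,0) + (1 + hc)·e₃`. [folklore] -/
def field (x : E3) : E3 :=
  fc x • hz x + gc x • rotGen x + (1 + hc x) • EuclideanSpace.single (2 : Fin 3) (1 : ℝ)

/-! ## Elementary inequalities -/

/-- `0 ≤ u`. [folklore] -/
theorem uu_nonneg (x : E3) : 0 ≤ uu x := by unfold uu; positivity
/-- `1 ≤ b`. [folklore] -/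
theorem one_le_bb (x : E3) : 1 ≤ bb x := by unfold bb; nlinarith [sq_nonneg (x 2)]
/-- `0 < b`. [folklore] -/
theorem bb_pos (x : E3) : 0 < bb x := lt_of_lt_of_le one_pos (one_le_bb x)
/-- `1 ≤ Q`. [folklore] -/
theorem one_le_QQ (x : E3) : 1 ≤ QQ x := by
  unfold QQ; linarith [uu_nonneg x, one_le_bb x]

/-- `0 < Q`. [folklore] -/
theorem QQ_pos (x : E3) : 0 < QQ x := lt_of_lt_of_le one_pos (one_le_QQ x)
/-- `Q ≠ 0`. [folklore] -/
theorem QQ_ne_zero (x : E3) : QQ x ≠ 0 := (QQ_pos x).ne'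

/-- `N ≥ (3/2)·b·Q³`: `u b ≤ Q²/4` (AM–GM, `Q = u + b`) gives `u b² ≤ b Q²/4 ≤ b Q³/4` and
`u² x₂² ≤ u² b ≤ u Q²/4 ≤ Q³/4 ≤ b Q³/4`. [folklore] -/
theorem NN_ge (x : E3) : 3 / 2 * bb x * QQ x ^ 3 ≤ NN x := by
  have hu := uu_nonneg x
  have hb := one_le_bb x
  have hQ := one_le_QQ x
  have hQdef : QQ x = uu x + bb x := rfl
  have hx2 : x 2 ^ 2 ≤ bb x := by unfold bb; linarith
  have hub : uu x * bb x ≤ QQ x ^ 2 / 4 := by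
    rw [hQdef]; nlinarith [sq_nonneg (uu x - bb x)]
  have h1 : uu x * bb x ^ 2 ≤ bb x * QQ x ^ 3 / 4 := by
    have : uu x * bb x ^ 2 = bb x * (uu x * bb x) := by ring
    rw [this]
    have hb0 : 0 ≤ bb x := by linarith
    have hQ23 : QQ x ^ 2 ≤ QQ x ^ 3 := pow_le_pow_right₀ hQ (by norm_num)
    calc bb x * (uu x * bb x) ≤ bb x * (QQ x ^ 2 / 4) := mul_le_mul_of_nonneg_left hub hb0
      _ ≤ bb x * QQ x ^ 3 / 4 := by nlinarith [mul_le_mul_of_nonneg_left hQ23 hb0]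
  have h2 : uu x ^ 2 * x 2 ^ 2 ≤ bb x * QQ x ^ 3 / 4 := by
    have hA : uu x ^ 2 * x 2 ^ 2 ≤ uu x * (uu x * bb x) := by
      have : uu x * (uu x * bb x) = uu x ^ 2 * bb x := by ring
      rw [this]; exact mul_le_mul_of_nonneg_left hx2 (by positivity)
    have hB : uu x * (uu x * bb x) ≤ uu x * (QQ x ^ 2 / 4) := mul_le_mul_of_nonneg_left hub hu
    have hC : uu x ≤ QQ x := by rw [hQdef]; linarith
    have hD : uu x * (QQ x ^ 2 / 4) ≤ QQ x ^ 3 / 4 := by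
      have := mul_le_mul_of_nonneg_right hC (sq_nonneg (QQ x))
      nlinarith [this]
    have hE : QQ x ^ 3 / 4 ≤ bb x * QQ x ^ 3 / 4 := by nlinarith [pow_pos (QQ_pos x) 3]
    linarith
  unfold NN
  linarith

/-- `N > 0` everywhere. [folklore] -/
theorem NN_pos (x : E3) : 0 < NN x :=
  lt_of_lt_of_le (by have := bb_pos x; have := pow_pos (QQ_pos x) 3; positivity) (NN_ge x)

/-! ## Components and constant speed -/

/-- `(x₀,x₁,0)₀ = x₀`. [folklore] -/
@[simp] theorem hz_apply_zero (x : E3) : hz x 0 = x 0 := by simp [hz]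
/-- `(x₀,x₁,0)₁ = x₁`. [folklore] -/
@[simp] theorem hz_apply_one (x : E3) : hz x 1 = x 1 := by simp [hz]
/-- `(x₀,x₁,0)₂ = 0`. [folklore] -/
@[simp] theorem hz_apply_two (x : E3) : hz x 2 = 0 := by simp [hz]

/-- `v₀ = fc·x₀ − gc·x₁`. [folklore] -/
theorem field_apply_zero (x : E3) : field x 0 = fc x * x 0 - gc x * x 1 := by
  simp [field, rotGen]; ring

/-- `v₁ = fc·x₁ + gc·x₀`. [folklore] -/
theorem field_apply_one (x : E3) : field x 1 = fc x * x 1 + gc x * x 0 := by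
  simp [field, rotGen]

/-- `v₂ = 1 + hc`. [folklore] -/
theorem field_apply_two (x : E3) : field x 2 = 1 + hc x := by
  simp [field]

/-- The speed budget: `u·fc² + u·gc² + (1 + hc)² = 1`. [folklore] -/
theorem speed_budget (x : E3) : uu x * fc x ^ 2 + uu x * gc x ^ 2 + (1 + hc x) ^ 2 = 1 := by
  have hQ := QQ_ne_zero x
  have hg : gc x ^ 2 = NN x / QQ x ^ 6 := by
    rw [gc, div_pow, Real.sq_sqrt (NN_pos x).le]; ring
  rw [hg, fc, hc, NN]
  field_simp
  ring

/-- **Constant speed**: `‖v x‖ = 1` for every `x`. [folklore] -/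
theorem norm_field (x : E3) : ‖field x‖ = 1 := by
  have h2 : ‖field x‖ ^ 2 = 1 := by
    rw [EuclideanSpace.norm_eq, Real.sq_sqrt (Finset.sum_nonneg fun i _ => sq_nonneg _)]
    simp only [Fin.sum_univ_three, Real.norm_eq_abs, sq_abs, field_apply_zero, field_apply_one, field_apply_two]
    have := speed_budget x
    rw [uu] at this
    linear_combination this
  have h0 : 0 ≤ ‖field x‖ := norm_nonneg _
  nlinarith [h2, h0]


/-! ## Calculus: derivatives of the building blocks -/

/-- The coordinate functions are the projections. [folklore] -/
private theorem hasFDerivAt_coord (j : Fin 3) (x : E3) :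
    HasFDerivAt (fun y : E3 => y j) (EuclideanSpace.proj j : E3 →L[ℝ] ℝ) x :=
  (EuclideanSpace.proj j : E3 →L[ℝ] ℝ).hasFDerivAt

/-- `Du = 2x₀ dx₀ + 2x₁ dx₁`. [folklore] -/
theorem hasFDerivAt_uu (x : E3) :
    HasFDerivAt uu ((2 * x 0) • (EuclideanSpace.proj (0 : Fin 3) : E3 →L[ℝ] ℝ) +
      (2 * x 1) • (EuclideanSpace.proj (1 : Fin 3) : E3 →L[ℝ] ℝ)) x := by
  show HasFDerivAt (fun y : E3 => y 0 ^ 2 + y 1 ^ 2) _ x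
  refine (((hasFDerivAt_coord 0 x).pow 2).fun_add ((hasFDerivAt_coord 1 x).pow 2)).congr_fderiv ?_
  refine ContinuousLinearMap.ext fun v => ?_
  simp

/-- `Db = 2x₂ dx₂`. [folklore] -/
theorem hasFDerivAt_bb (x : E3) :
    HasFDerivAt bb ((2 * x 2) • (EuclideanSpace.proj (2 : Fin 3) : E3 →L[ℝ] ℝ)) x := by
  show HasFDerivAt (fun y : E3 => y 2 ^ 2 + 1) _ x
  refine (((hasFDerivAt_coord 2 x).pow 2).add_const (1 : ℝ)).congr_fderiv ?_
  refine ContinuousLinearMap.ext fun v => ?_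
  simp

/-- `DQ = 2x₀ dx₀ + 2x₁ dx₁ + 2x₂ dx₂`. [folklore] -/
theorem hasFDerivAt_QQ (x : E3) :
    HasFDerivAt QQ ((2 * x 0) • (EuclideanSpace.proj (0 : Fin 3) : E3 →L[ℝ] ℝ) +
      (2 * x 1) • (EuclideanSpace.proj (1 : Fin 3) : E3 →L[ℝ] ℝ) +
      (2 * x 2) • (EuclideanSpace.proj (2 : Fin 3) : E3 →L[ℝ] ℝ)) x :=
  (hasFDerivAt_uu x).fun_add (hasFDerivAt_bb x)

/-- `D(Q⁻¹) = −Q⁻² DQ`. [folklore] -/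
theorem hasFDerivAt_inv_QQ (x : E3) :
    HasFDerivAt (fun y => (QQ y)⁻¹) ((-(QQ x ^ 2)⁻¹) • ((2 * x 0) • (EuclideanSpace.proj (0 : Fin 3) : E3 →L[ℝ] ℝ) +
      (2 * x 1) • (EuclideanSpace.proj (1 : Fin 3) : E3 →L[ℝ] ℝ) +
      (2 * x 2) • (EuclideanSpace.proj (2 : Fin 3) : E3 →L[ℝ] ℝ))) x := by
  have h := (hasDerivAt_inv (QQ_ne_zero x)).comp_hasFDerivAt x (hasFDerivAt_QQ x)
  refine h.congr_fderiv ?_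
  refine ContinuousLinearMap.ext fun v => ?_
  simp

/-! ## Smoothness (all orders, including `ω`: the field is real analytic) -/

/-- The coordinate functions are `Cⁿ`. [folklore] -/
private theorem contDiff_coord {n : WithTop ℕ∞} (j : Fin 3) : ContDiff ℝ n (fun y : E3 => y j) :=
  (EuclideanSpace.proj j : E3 →L[ℝ] ℝ).contDiff

/-- `u` is `Cⁿ`. [folklore] -/
theorem contDiff_uu {n : WithTop ℕ∞} : ContDiff ℝ n uu :=
  ((contDiff_coord 0).pow 2).add ((contDiff_coord 1).pow 2)
/-- `b` is `Cⁿ`. [folklore] -/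
theorem contDiff_bb {n : WithTop ℕ∞} : ContDiff ℝ n bb :=
  ((contDiff_coord 2).pow 2).add contDiff_const
/-- `Q` is `Cⁿ`. [folklore] -/
theorem contDiff_QQ {n : WithTop ℕ∞} : ContDiff ℝ n QQ :=
  contDiff_uu.add contDiff_bb
/-- `N` is `Cⁿ`. [folklore] -/
theorem contDiff_NN {n : WithTop ℕ∞} : ContDiff ℝ n NN :=
  (((contDiff_const.mul contDiff_bb).mul (contDiff_QQ.pow 3)).sub (contDiff_uu.mul (contDiff_bb.pow 2))).sub
    ((contDiff_uu.pow 2).mul ((contDiff_coord 2).pow 2))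

/-- `fc` is `Cⁿ` (`Q ≠ 0`). [folklore] -/
theorem contDiff_fc {n : WithTop ℕ∞} : ContDiff ℝ n fc :=
  (contDiff_uu.mul (contDiff_coord 2)).neg.div (contDiff_QQ.pow 3) fun x => pow_ne_zero 3 (QQ_ne_zero x)

/-- `gc` is `Cⁿ` (`N > 0`, `Q ≠ 0`; `√·` is analytic off `0`). [folklore] -/
theorem contDiff_gc {n : WithTop ℕ∞} : ContDiff ℝ n gc :=
  (contDiff_NN.sqrt fun x => (NN_pos x).ne').div (contDiff_QQ.pow 3) fun x => pow_ne_zero 3 (QQ_ne_zero x)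

/-- `hc` is `Cⁿ` (`Q ≠ 0`). [folklore] -/
theorem contDiff_hc {n : WithTop ℕ∞} : ContDiff ℝ n hc :=
  (contDiff_uu.mul contDiff_bb).neg.div (contDiff_QQ.pow 3) fun x => pow_ne_zero 3 (QQ_ne_zero x)

/-- The horizontal projection is `Cⁿ`. [folklore] -/
theorem contDiff_hz {n : WithTop ℕ∞} : ContDiff ℝ n hz :=
  contDiff_id.sub ((contDiff_coord 2).smul contDiff_const)
/-- The rotation generator `J` is `Cⁿ` (linear). [folklore] -/
theorem contDiff_rotGen {n : WithTop ℕ∞} : ContDiff ℝ n (rotGen : E3 → E3) :=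
  rotGenL.contDiff

/-- **The example field is `Cⁿ` for every `n ≤ ω`** (in particular smooth and real analytic). [folklore] -/
theorem contDiff_field {n : WithTop ℕ∞} : ContDiff ℝ n field :=
  ((contDiff_fc.smul contDiff_hz).add (contDiff_gc.smul contDiff_rotGen)).add
    ((contDiff_const.add contDiff_hc).smul contDiff_const)

/-- The example field is real analytic on `ℝ³`. [folklore] -/
theorem analyticOnNhd_field : AnalyticOnNhd ℝ field univ :=
  (contDiff_field (n := ⊤)).analyticOnNhd


/-! ## Derivatives of the coefficients `fc`, `hc`, and axisymmetry of `gc` -/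

/-- `D fc`: `∂₀fc = 2x₀x₂(3u − Q)/Q⁴`, `∂₁fc = 2x₁x₂(3u − Q)/Q⁴`, `∂₂fc = u(6x₂² − Q)/Q⁴`. [folklore] -/
theorem hasFDerivAt_fc (x : E3) :
    HasFDerivAt fc ((2 * x 0 * x 2 * (3 * uu x - QQ x) / QQ x ^ 4) • (EuclideanSpace.proj (0 : Fin 3) : E3 →L[ℝ] ℝ) +
      (2 * x 1 * x 2 * (3 * uu x - QQ x) / QQ x ^ 4) • (EuclideanSpace.proj (1 : Fin 3) : E3 →L[ℝ] ℝ) +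
      (uu x * (6 * x 2 ^ 2 - QQ x) / QQ x ^ 4) • (EuclideanSpace.proj (2 : Fin 3) : E3 →L[ℝ] ℝ)) x := by
  have hQ := QQ_ne_zero x
  have e : fc = fun y => -(uu y * y 2) * ((QQ y)⁻¹) ^ 3 := by
    funext y; rw [fc, inv_pow, div_eq_mul_inv]
  rw [e]
  refine ((((hasFDerivAt_uu x).fun_mul (hasFDerivAt_coord 2 x)).neg).fun_mul
    ((hasFDerivAt_inv_QQ x).pow 3)).congr_fderiv ?_
  refine ContinuousLinearMap.ext fun v => ?_
  simp
  field_simp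
  ring

/-- `D hc`: `∂₀hc = 2x₀b(3u − Q)/Q⁴`, `∂₁hc = 2x₁b(3u − Q)/Q⁴`, `∂₂hc = 2x₂u(3b − Q)/Q⁴`. [folklore] -/
theorem hasFDerivAt_hc (x : E3) :
    HasFDerivAt hc ((2 * x 0 * bb x * (3 * uu x - QQ x) / QQ x ^ 4) • (EuclideanSpace.proj (0 : Fin 3) : E3 →L[ℝ] ℝ) +
      (2 * x 1 * bb x * (3 * uu x - QQ x) / QQ x ^ 4) • (EuclideanSpace.proj (1 : Fin 3) : E3 →L[ℝ] ℝ) +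
      (2 * x 2 * uu x * (3 * bb x - QQ x) / QQ x ^ 4) • (EuclideanSpace.proj (2 : Fin 3) : E3 →L[ℝ] ℝ)) x := by
  have hQ := QQ_ne_zero x
  have e : hc = fun y => -(uu y * bb y) * ((QQ y)⁻¹) ^ 3 := by
    funext y; rw [hc, inv_pow, div_eq_mul_inv]
  rw [e]
  refine ((((hasFDerivAt_uu x).fun_mul (hasFDerivAt_bb x)).neg).fun_mul
    ((hasFDerivAt_inv_QQ x).pow 3)).congr_fderiv ?_
  refine ContinuousLinearMap.ext fun v => ?_
  simp
  field_simp
  ring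

/-- `u` is invariant under rotations about the axis. [folklore] -/
theorem uu_rotZ (θ : ℝ) (x : E3) : uu (rotZ θ x) = uu x := by
  simp only [uu, rotZ_apply_zero, rotZ_apply_one]
  linear_combination (x 0 ^ 2 + x 1 ^ 2) * Real.sin_sq_add_cos_sq θ
/-- `b` is invariant under rotations about the axis. [folklore] -/
theorem bb_rotZ (θ : ℝ) (x : E3) : bb (rotZ θ x) = bb x := by simp only [bb, rotZ_apply_two]
/-- `Q` is invariant under rotations about the axis. [folklore] -/
theorem QQ_rotZ (θ : ℝ) (x : E3) : QQ (rotZ θ x) = QQ x := by simp only [QQ, uu_rotZ, bb_rotZ]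
/-- The swirl coefficient `gc` is an axisymmetric scalar. [folklore] -/
theorem gc_rotZ (θ : ℝ) (x : E3) : gc (rotZ θ x) = gc x := by
  simp only [gc, NN, QQ_rotZ, uu_rotZ, bb_rotZ, rotZ_apply_two]

/-- Hence `D gc (x)[J x] = 0` (`J x = (−x₁, x₀, 0)`). [folklore] -/
theorem fderiv_gc_rotGen (x : E3) : fderiv ℝ gc x (rotGen x) = 0 :=
  fderiv_apply_rotGen_eq_zero_of_forall_rotZ (fun θ => gc_rotZ θ x)
    ((contDiff_gc (n := 1)).differentiable one_ne_zero x)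

/-! ## The derivative of the field and its divergence -/

/-- The horizontal projection `y ↦ (y₀, y₁, 0)` as a continuous linear map. [folklore] -/
theorem hasFDerivAt_hz (x : E3) :
    HasFDerivAt hz (ContinuousLinearMap.id ℝ E3 -
      (EuclideanSpace.proj (2 : Fin 3) : E3 →L[ℝ] ℝ).smulRight (EuclideanSpace.single (2 : Fin 3) (1 : ℝ))) x := by
  show HasFDerivAt (fun y : E3 => y - (y 2) • EuclideanSpace.single (2 : Fin 3) (1 : ℝ)) _ x
  exact (hasFDerivAt_id x).fun_sub ((hasFDerivAt_coord 2 x).smul_const _)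

/-- **The derivative of the example field** (Leibniz). [folklore] -/
theorem hasFDerivAt_field (x : E3) :
    HasFDerivAt field
      (fc x • (ContinuousLinearMap.id ℝ E3 -
          (EuclideanSpace.proj (2 : Fin 3) : E3 →L[ℝ] ℝ).smulRight (EuclideanSpace.single (2 : Fin 3) (1 : ℝ))) +
        (fderiv ℝ fc x).smulRight (hz x) +
      (gc x • rotGenL + (fderiv ℝ gc x).smulRight (rotGen x)) +
      (fderiv ℝ hc x).smulRight (EuclideanSpace.single (2 : Fin 3) (1 : ℝ))) x := by
  have hfc : HasFDerivAt fc (fderiv ℝ fc x) x := (hasFDerivAt_fc x).differentiableAt.hasFDerivAt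
  have hgc : HasFDerivAt gc (fderiv ℝ gc x) x :=
    ((contDiff_gc (n := 1)).differentiable one_ne_zero x).hasFDerivAt
  have hhc : HasFDerivAt (fun y => 1 + hc y) (fderiv ℝ hc x) x := by
    simpa using (hasFDerivAt_hc x).differentiableAt.hasFDerivAt.const_add (1 : ℝ)
  exact ((hfc.smul (hasFDerivAt_hz x)).add (hgc.smul (hasFDerivAt_rotGen x))).add (hhc.smul_const _)

/-- **The example field is divergence free.**  `div v = 2 fc + ⟪∇fc, (x₀,x₁,0)⟫ + ⟪∇gc, J x⟫ + ∂₂hc`, the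
`gc`-term vanishes by axisymmetry and the rest is the identity `2∂_u(u·fc) + ∂₂ hc = 0`. [folklore] -/
theorem isDivFree_field : VectorCalculus.IsDivFree field := by
  intro x
  have hQ := QQ_ne_zero x
  have hg0 := fderiv_gc_rotGen x
  rw [rotGen_eq_sub_single, map_sub, map_smul, map_smul, smul_eq_mul, smul_eq_mul] at hg0
  rw [VectorCalculus.divergence, (hasFDerivAt_field x).fderiv, trace_eq_sum_coord, Fin.sum_univ_three,
    (hasFDerivAt_fc x).fderiv, (hasFDerivAt_hc x).fderiv]
  simp [rotGen]
  have hu : uu x = x 0 ^ 2 + x 1 ^ 2 := rfl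
  have hQ' : QQ x = uu x + bb x := rfl
  rw [fc]
  field_simp
  rw [hQ', hu]
  linear_combination (x 0 ^ 2 + x 1 ^ 2 + bb x) ^ 4 * hg0


/-! ## The field is not constant -/

/-- On the axis the field is the far-field value: `v(0) = e₃`. [folklore] -/
theorem field_zero : field 0 = EuclideanSpace.single (2 : Fin 3) (1 : ℝ) := by
  ext i
  fin_cases i <;> simp [field_apply_zero, field_apply_one, field_apply_two, hc, uu]

/-- At `x = e₀` the axial component is `7/8`: the field is NOT constant. [folklore] -/
theorem field_single_zero_apply_two : field (EuclideanSpace.single (0 : Fin 3) (1 : ℝ)) 2 = 7 / 8 := by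
  rw [field_apply_two, hc, QQ, uu, bb]
  simp
  norm_num

/-- The example field is not the constant `e₃`. [folklore] -/
theorem field_ne_const : ¬ ∀ x, field x = EuclideanSpace.single (2 : Fin 3) (1 : ℝ) := by
  intro h
  have h2 := congrArg (fun v : E3 => v 2) (h (EuclideanSpace.single (0 : Fin 3) (1 : ℝ)))
  simp only [field_single_zero_apply_two] at h2
  norm_num at h2

end ConstantSpeedExample

end ExtremiserLiouville

end Summit.NavierStokesRegularity.NavierStokesRegularity.Theorems

end
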